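import Literature.NumberTheory.Automorphic.UnitaryGroupCohomologicalForms
import Literature.NumberTheory.Automorphic.UnitaryGroupArchFactor
import HarnessLib

/-!
# Crux `H413`, line `F0_P2aCohIsotypicLine` — THE FRAME TRANSPORT `(L, ι, H, T, hT) ↦ (L, ι, H, T', hT')` and `↦` the pin
# `archFactorOf F V` (B4-archimedean desk, seat F0P2a-p06 (g0); served item `stmt-HodgeConjecture-24833`; shared by S3 / L2b / S2β)

HC_CM is proved only modulo the printed citations until rung 0 closes.

The archimedean stubs of the desk lines (`Cruxes/H413/Lines/F0_P2aCohIsotypicLine.lean`, S2⁺ S2⁻ S2β S3; `F0_P2aHodgeRealisation.lean`)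
speak about the CM engine datum `(L, ι, H, T, hT)`: a CM field `L`, an embedding `ι`, `H ∈ M₃(L)` and a FRAME `T ∈ GL₃(ℂ)` with
`Tᴴ · H^ι · T = J = diag(1,1,−1)`, through the carriers ★ `CotangentForms.holCotForms … (cmArchSection L ι H T hT) (cmCompactFactor L ι H T hT)`,
whereas every realisation theorem of the tree (the tower isomorphism ★ `CuspCot.exists_cohClassMap_bijective`, the Hodge decomposition of the tower,
P2-U1′, P4-T2, the regime model) is stated AT THE PIN: a bundled CM field `F : HodgeCM.CMField`, a hermitian space `V : HodgeCM.HermSpace3 F ι₁`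
and the archimedean factor OF RECORD `archFactorOf F V`, whose section goes through HodgeCM's CHOSEN Sylvester frame `V.sylvesterFrame`.
This file is the bridge, THEOREMS ONLY (no `def`, no instance, no named fact, no `sorry`):

* §1 GENERIC TRANSPORT along an intertwined pair of archimedean sections (any unitary datum `(F, E, c, N, J)`, sections
  `ι₁ ι₂ : U(2,1) →* U(J)(𝔸_F)`, `a ∈ U(J)(𝔸_F)` with `ι₂(u) · a = a · ι₁(u)`, `a` commuting with `K_c` and with `U(J)(𝔸_{F,f})`): right
  translation `Φ ↦ Φ(· a)` carries holomorphic germs along `ι₁` to holomorphic germs along `ι₂` (`isHolGerm_comp_mul_right_of_rel`), weight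
  forms to weight forms, smooth vectors to smooth vectors, hence `holCotForms ι₁ K_c → holCotForms ι₂ K_c` (`mem_holCotForms_comp_mul_right_of_rel`),
  the same for the conjugates (`mem_map_conjFun_comp_mul_right_of_rel`) and for `cohForms` (`mem_cohForms_comp_mul_right_of_rel`);
* §2 FRAMES (CM datum, two frames `T, T'` of the same `(L, ι, H)`): `u₀ := T'⁻¹ T ∈ U(2,1)` (`inv_mul_mem_U21`), the sections are CONJUGATE,
  `cmArchSection T u = cmArchSection T' (u₀ u u₀⁻¹)` (`exists_cmArchSection_eq_conj`), the compact factor is FRAME-FREE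
  (`cmCompactFactor_eq_of_frames`, ★ `ker_archProjU21Emb`), and the section commutes with `U(H)(𝔸_{L⁺,f})` and with `K_c`
  (`commute_finAdelicToAdelic_cmArchSection`, `commute_cmArchSection_of_mem_cmCompactFactor`; ★ `commute_archSectionU21CM_of_mem_awayFromCM`);
* §3 THE FRAME TRANSPORT `exists_frameTransport`: `∃ a` (namely `cmArchSection T' u₀⁻¹`) commuting with `U(H)(𝔸_{L⁺,f})` such that
  `Φ ∈ hol_T ↔ Φ(· a) ∈ hol_{T'}`, `Φ ∈ antihol_T ↔ Φ(· a) ∈ antihol_{T'}`, `Φ ∈ coh_T ↔ Φ(· a) ∈ coh_{T'}` — the consumer shape asked for by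
  F0P2a-p07 (S3 closer) on the desk bus 2026-08-30T23:24:05Z, one-way spelling `mem_cohForms_frameTransport`;
* the PIN PACKAGING (every CM engine datum IS a pin `(F, V)`; transport to `CohFormsCarriers.cohForms (archFactorOf F V)`) is the companion
  file `Theorems/F0P2aFrameTransportPin.lean` (it needs the Summit-side carriers ★ `H413CohFormsCarriers`; this file is Literature-footed).

Mathematically this is the remark that two frames of the same hermitian form differ by an element `u₀` of `U(2,1)` ([PlatonovRapinchuk1994, §2.3]),
that the embedded factor `U(H)(L⁺_{v(ι)}) ≅ U(2,1)` is then conjugated by `u₀` while the other archimedean factors and the finite adeles are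
untouched ([BorelJacquet1979, §4.1]: `G(𝔸) = G_∞ × G(𝔸_f)`, `G_∞ = ∏_v G(F_v)`), and that right translation by a group element commuting with
`K_c · G(𝔸_f)` preserves `K_∞`-type, level and holomorphy of automorphic forms read on the group ([Borel1997, §5.14]; [BorelWallach2000, VII 2.10]).

## References
* [BorelJacquet1979] A. Borel, H. Jacquet, *Automorphic forms and automorphic representations*, PSPM 33.1 (1979), §4.1, §4.2.
* [PlatonovRapinchuk1994] V. Platonov, A. Rapinchuk, *Algebraic groups and number theory* (1994), §2.3 (isometric forms, conjugate unitary groups).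
* [Borel1997] A. Borel, *Automorphic forms on SL₂(ℝ)* (1997), §5.14 (forms of a given `K`-type as functions on the group).
* [BorelWallach2000] A. Borel, N. Wallach, 2nd ed. (2000), VII 2.10 (holomorphic / antiholomorphic cotangent forms).
* [BergeronMillsonMoeglin2016Balls] N. Bergeron, J. Millson, C. Moeglin, Part 2 §1.1 (frames of a hermitian form of signature `(p,q)`).
-/

-- the mandated namespace repeats `HodgeConjecture.HodgeConjecture`, as in every `Theorems/*.lean` of this sub-problem
set_option linter.dupNamespace false
set_option autoImplicit false

noncomputable section

open NumberField MulAction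
open scoped Matrix ComplexOrder

namespace Summit.HodgeConjecture.HodgeConjecture.Cruxes.H413.F0P2aFrameTransport

open Literature.NumberTheory.Automorphic Literature.NumberTheory.Automorphic.UnitaryGroup
open Literature.NumberTheory.Automorphic.UnitaryGroup.CotangentForms
open Literature.AlgebraicGeometry.ShimuraVarieties
open Literature.Geometry.ComplexHyperbolic
open Literature.Geometry.ComplexHyperbolic.BallModel (U21 x₀)

/-! ## §1 Generic transport of cotangent forms along an intertwined pair of archimedean sections -/

section Generic

variable {F E : Type} [Field F] [NumberField F] [Field E] [NumberField E] [Algebra F E]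
  {c : E ≃ₐ[F] E} {N : ℕ} {J : Matrix (Fin N) (Fin N) E}
  {ι₁ ι₂ : U21 →* (adelicGroupData F E c N J).Adelic} {Kc : Subgroup (adelicGroupData F E c N J).Adelic}
  {a : (adelicGroupData F E c N J).Adelic}

/-- **The archimedean probe of a right translate**: if `ι₂(u) · a = a · ι₁(u)` for all `u ∈ U(2,1)`, the probe of `Φ(· a)` along `ι₂` at `y`
IS the probe of `Φ` along `ι₁` at `y · a` (same function of the ball parameter `b`). [cite: Borel1997, §5.14] -/
theorem germAt_comp_mul_right_of_rel (hrel : ∀ u : U21, ι₂ u * a = a * ι₁ u)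
    (Φ : (adelicGroupData F E c N J).Adelic → (Fin 2 → ℂ)) (y : (adelicGroupData F E c N J).Adelic) :
    germAt ι₂ (fun g => Φ (g * a)) y = germAt ι₁ Φ (y * a) := by
  funext b
  show Φ (y * ι₂ (BallForms.expP b) * a) = Φ (y * a * ι₁ (BallForms.expP b))
  rw [mul_assoc y, hrel, ← mul_assoc]

/-- **Holomorphic germs ride along an intertwined right translation**: `IsHolGerm ι₁ Φ → IsHolGerm ι₂ (Φ(· a))` when `ι₂(u) a = a ι₁(u)`
(the probes agree, `germAt_comp_mul_right_of_rel`; compare ★ `IsHolGerm.comp_mul_right`, the case `ι₁ = ι₂`). [cite: Borel1997, §5.14]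
[cite: BorelWallach2000, VII 2.10] -/
theorem isHolGerm_comp_mul_right_of_rel (hrel : ∀ u : U21, ι₂ u * a = a * ι₁ u)
    {Φ : (adelicGroupData F E c N J).Adelic → (Fin 2 → ℂ)} (hΦ : IsHolGerm ι₁ Φ) : IsHolGerm ι₂ (fun g => Φ (g * a)) :=
  ⟨fun y => by rw [germAt_comp_mul_right_of_rel hrel]; exact hΦ.1 (y * a),
    fun y v => by rw [germAt_comp_mul_right_of_rel hrel]; exact hΦ.2 (y * a) v⟩

/-- **Weight forms ride along an intertwined right translation**: left `Γ`-invariance is untouched and the `K_∞`-type along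
`ι₁ ∘ incl_S` becomes the same `K_∞`-type along `ι₂ ∘ incl_S` (`Φ(g ι₂(k) a) = Φ(g a ι₁(k)) = τ(k)⁻¹ Φ(g a)`). [cite: Borel1997, §5.14] -/
theorem mem_weightForms_comp_mul_right_of_rel (hrel : ∀ u : U21, ι₂ u * a = a * ι₁ u)
    {Γ : Subgroup (adelicGroupData F E c N J).Adelic} {S : Subgroup U21} {R W : Type*} [CommRing R] [AddCommGroup W] [Module R W]
    {τ : Representation R S W} {Φ : (adelicGroupData F E c N J).Adelic → W}
    (hΦ : Φ ∈ weightForms Γ (ι₁.comp S.subtype) τ) : (fun g => Φ (g * a)) ∈ weightForms Γ (ι₂.comp S.subtype) τ := by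
  refine ⟨fun γ hγ g => ?_, fun k g => ?_⟩
  · show Φ (γ * g * a) = Φ (g * a)
    rw [mul_assoc, hΦ.1 γ hγ (g * a)]
  · have h2 : Φ (g * a * ι₁ (k : U21)) = τ k⁻¹ (Φ (g * a)) := hΦ.2 k (g * a)
    show Φ (g * ι₂ (k : U21) * a) = τ k⁻¹ (Φ (g * a))
    rw [mul_assoc g, hrel, ← mul_assoc]
    exact h2

/-- Right translation by an element commuting with the finite adeles commutes with the finite-adelic right translation `rightRep`.
[cite: BorelJacquet1979, §4.2] -/
theorem rightRep_comp_mul_right (haf : ∀ g : finAdelic F E c N J, Commute (finAdelicToAdelic F E c N J g) a)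
    (g : finAdelic F E c N J) (Φ : (adelicGroupData F E c N J).Adelic → (Fin 2 → ℂ)) :
    rightRep F E c N J g (fun y => Φ (y * a)) = fun y => rightRep F E c N J g Φ (y * a) := by
  funext x
  simp only [rightRep_apply]
  rw [mul_assoc, (haf g).eq, ← mul_assoc]

/-- **Smooth vectors ride along a right translation commuting with `U(J)(𝔸_{F,f})`**: a function fixed by an open `K_f` stays fixed by `K_f`.
[cite: BorelJacquet1979, §4.2] -/
theorem mem_smoothFun_comp_mul_right (haf : ∀ g : finAdelic F E c N J, Commute (finAdelicToAdelic F E c N J g) a)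
    {Φ : (adelicGroupData F E c N J).Adelic → (Fin 2 → ℂ)} (hΦ : Φ ∈ smoothFun F E c N J) :
    (fun y => Φ (y * a)) ∈ smoothFun F E c N J := by
  -- right translation by `a` as a linear map (Mathlib `LinearMap.funLeft`)
  let La : ((adelicGroupData F E c N J).Adelic → (Fin 2 → ℂ)) →ₗ[ℂ] ((adelicGroupData F E c N J).Adelic → (Fin 2 → ℂ)) :=
    LinearMap.funLeft ℂ (Fin 2 → ℂ) fun y => y * a
  have hLa : ∀ Ψ : (adelicGroupData F E c N J).Adelic → (Fin 2 → ℂ), La Ψ = fun y => Ψ (y * a) := fun _ => rfl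
  have hle : (smoothFun F E c N J).map La ≤ smoothFun F E c N J := by
    unfold smoothFun
    simp only [Submodule.map_iSup]
    refine iSup₂_mono fun Kf _ => ?_
    intro x hx
    obtain ⟨Ψ, hΨ, rfl⟩ := Submodule.mem_map.mp hx
    rw [Representation.mem_invariants] at hΨ ⊢
    intro k
    have hk : rightRep F E c N J (k : finAdelic F E c N J) Ψ = Ψ := hΨ k
    show rightRep F E c N J (k : finAdelic F E c N J) (La Ψ) = La Ψ
    rw [hLa, rightRep_comp_mul_right haf, hk]
  rw [← hLa]
  exact hle (Submodule.mem_map_of_mem hΦ)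

/-- **Holomorphic cotangent forms ride along an intertwined right translation**: for `ι₂(u) · a = a · ι₁(u)` (`u ∈ U(2,1)`), `a` commuting with
`K_c` and with `U(J)(𝔸_{F,f})`, `Φ ∈ holCotForms ι₁ K_c ⇒ Φ(· a) ∈ holCotForms ι₂ K_c` (the four conjuncts of ★ `mem_holCotForms_iff` one by one).
[cite: Borel1997, §5.14] [cite: BorelWallach2000, VII 2.10] [cite: BorelJacquet1979, §4.2] -/
theorem mem_holCotForms_comp_mul_right_of_rel (hrel : ∀ u : U21, ι₂ u * a = a * ι₁ u)
    (haK : ∀ k ∈ Kc, Commute k a) (haf : ∀ g : finAdelic F E c N J, Commute (finAdelicToAdelic F E c N J g) a)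
    {Φ : (adelicGroupData F E c N J).Adelic → (Fin 2 → ℂ)} (hΦ : Φ ∈ holCotForms F E c N J ι₁ Kc) :
    (fun y => Φ (y * a)) ∈ holCotForms F E c N J ι₂ Kc := by
  rw [mem_holCotForms_iff] at hΦ ⊢
  obtain ⟨hw, hK, hs, hh⟩ := hΦ
  refine ⟨mem_weightForms_comp_mul_right_of_rel hrel hw, fun k hk x => ?_, mem_smoothFun_comp_mul_right haf hs,
    isHolGerm_comp_mul_right_of_rel hrel hh⟩
  show Φ (x * k * a) = Φ (x * a)
  rw [mul_assoc, (haK k hk).eq, ← mul_assoc, hK k hk]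

/-- Right translation commutes with componentwise complex conjugation: `conjFun Ψ (· a) = conjFun (Ψ(· a))`. [cite: BorelWallach2000, VII 2.10] -/
theorem conjFun_comp_mul_right (Ψ : (adelicGroupData F E c N J).Adelic → (Fin 2 → ℂ)) :
    (fun y => conjFun F E c N J Ψ (y * a)) = conjFun F E c N J (fun y => Ψ (y * a)) := by
  funext y
  rw [conjFun_apply, conjFun_apply]

/-- **Antiholomorphic cotangent forms ride along an intertwined right translation** (`Φ = Ψ̄ ↦ Φ(· a) = \overline{Ψ(· a)}`).
[cite: BorelWallach2000, VII 2.10] -/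
theorem mem_map_conjFun_comp_mul_right_of_rel (hrel : ∀ u : U21, ι₂ u * a = a * ι₁ u)
    (haK : ∀ k ∈ Kc, Commute k a) (haf : ∀ g : finAdelic F E c N J, Commute (finAdelicToAdelic F E c N J g) a)
    {Φ : (adelicGroupData F E c N J).Adelic → (Fin 2 → ℂ)} (hΦ : Φ ∈ (holCotForms F E c N J ι₁ Kc).map (conjFun F E c N J)) :
    (fun y => Φ (y * a)) ∈ (holCotForms F E c N J ι₂ Kc).map (conjFun F E c N J) := by
  obtain ⟨Ψ, hΨ, rfl⟩ := Submodule.mem_map.mp hΦ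
  rw [conjFun_comp_mul_right]
  exact Submodule.mem_map_of_mem (mem_holCotForms_comp_mul_right_of_rel hrel haK haf hΨ)

/-- **Cohomological cotangent forms ride along an intertwined right translation** (`cohForms = hol ⊔ conj hol`, translate the two parts).
[cite: BorelWallach2000, VII 2.10] -/
theorem mem_cohForms_comp_mul_right_of_rel (hrel : ∀ u : U21, ι₂ u * a = a * ι₁ u)
    (haK : ∀ k ∈ Kc, Commute k a) (haf : ∀ g : finAdelic F E c N J, Commute (finAdelicToAdelic F E c N J g) a)
    {Φ : (adelicGroupData F E c N J).Adelic → (Fin 2 → ℂ)} (hΦ : Φ ∈ cohForms F E c N J ι₁ Kc) :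
    (fun y => Φ (y * a)) ∈ cohForms F E c N J ι₂ Kc := by
  unfold cohForms at hΦ ⊢
  obtain ⟨Φ₁, h₁, Φ₂, h₂, rfl⟩ := Submodule.mem_sup.mp hΦ
  have hsum : (fun y => (Φ₁ + Φ₂) (y * a)) = (fun y => Φ₁ (y * a)) + fun y => Φ₂ (y * a) := rfl
  rw [hsum]
  exact Submodule.add_mem_sup (mem_holCotForms_comp_mul_right_of_rel hrel haK haf h₁)
    (mem_map_conjFun_comp_mul_right_of_rel hrel haK haf h₂)

/-- The intertwining relation reversed: `ι₂(u) a = a ι₁(u)` gives `ι₁(u) a⁻¹ = a⁻¹ ι₂(u)`. [folklore] -/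
theorem rel_symm (hrel : ∀ u : U21, ι₂ u * a = a * ι₁ u) : ∀ u : U21, ι₁ u * a⁻¹ = a⁻¹ * ι₂ u := fun u => by
  rw [mul_inv_eq_iff_eq_mul, mul_assoc, hrel u, inv_mul_cancel_left]

/-- Undoing the translation: `(Φ(· a))(· a⁻¹) = Φ`. [folklore] -/
theorem comp_mul_right_inv_cancel (Φ : (adelicGroupData F E c N J).Adelic → (Fin 2 → ℂ)) :
    (fun y => (fun z => Φ (z * a)) (y * a⁻¹)) = Φ := by
  funext y
  show Φ (y * a⁻¹ * a) = Φ y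
  rw [inv_mul_cancel_right]

/-- Undoing the translation the other way: `(Φ(· a⁻¹))(· a) = Φ`. [folklore] -/
theorem comp_mul_right_cancel_inv (Φ : (adelicGroupData F E c N J).Adelic → (Fin 2 → ℂ)) :
    (fun y => (fun z => Φ (z * a⁻¹)) (y * a)) = Φ := by
  funext y
  show Φ (y * a * a⁻¹) = Φ y
  rw [mul_inv_cancel_right]

/-- **`Φ ∈ holCotForms ι₁ K_c ↔ Φ(· a) ∈ holCotForms ι₂ K_c`** under the intertwining relation and the two commutations (the converse is the direct
statement for `(ι₂, ι₁, a⁻¹)`). [cite: Borel1997, §5.14] [cite: BorelWallach2000, VII 2.10] -/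
theorem mem_holCotForms_iff_comp_mul_right_of_rel (hrel : ∀ u : U21, ι₂ u * a = a * ι₁ u)
    (haK : ∀ k ∈ Kc, Commute k a) (haf : ∀ g : finAdelic F E c N J, Commute (finAdelicToAdelic F E c N J g) a)
    (Φ : (adelicGroupData F E c N J).Adelic → (Fin 2 → ℂ)) :
    Φ ∈ holCotForms F E c N J ι₁ Kc ↔ (fun y => Φ (y * a)) ∈ holCotForms F E c N J ι₂ Kc := by
  refine ⟨mem_holCotForms_comp_mul_right_of_rel hrel haK haf, fun h => ?_⟩
  have h' := mem_holCotForms_comp_mul_right_of_rel (rel_symm hrel) (fun k hk => (haK k hk).inv_right)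
    (fun g => (haf g).inv_right) h
  rwa [comp_mul_right_inv_cancel] at h'

/-- **`Φ ∈ conj holCotForms ι₁ K_c ↔ Φ(· a) ∈ conj holCotForms ι₂ K_c`.** [cite: BorelWallach2000, VII 2.10] -/
theorem mem_map_conjFun_iff_comp_mul_right_of_rel (hrel : ∀ u : U21, ι₂ u * a = a * ι₁ u)
    (haK : ∀ k ∈ Kc, Commute k a) (haf : ∀ g : finAdelic F E c N J, Commute (finAdelicToAdelic F E c N J g) a)
    (Φ : (adelicGroupData F E c N J).Adelic → (Fin 2 → ℂ)) :
    Φ ∈ (holCotForms F E c N J ι₁ Kc).map (conjFun F E c N J) ↔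
      (fun y => Φ (y * a)) ∈ (holCotForms F E c N J ι₂ Kc).map (conjFun F E c N J) := by
  refine ⟨mem_map_conjFun_comp_mul_right_of_rel hrel haK haf, fun h => ?_⟩
  have h' := mem_map_conjFun_comp_mul_right_of_rel (rel_symm hrel) (fun k hk => (haK k hk).inv_right)
    (fun g => (haf g).inv_right) h
  rwa [comp_mul_right_inv_cancel] at h'

/-- **`Φ ∈ cohForms ι₁ K_c ↔ Φ(· a) ∈ cohForms ι₂ K_c`.** [cite: BorelWallach2000, VII 2.10] -/
theorem mem_cohForms_iff_comp_mul_right_of_rel (hrel : ∀ u : U21, ι₂ u * a = a * ι₁ u)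
    (haK : ∀ k ∈ Kc, Commute k a) (haf : ∀ g : finAdelic F E c N J, Commute (finAdelicToAdelic F E c N J g) a)
    (Φ : (adelicGroupData F E c N J).Adelic → (Fin 2 → ℂ)) :
    Φ ∈ cohForms F E c N J ι₁ Kc ↔ (fun y => Φ (y * a)) ∈ cohForms F E c N J ι₂ Kc := by
  refine ⟨mem_cohForms_comp_mul_right_of_rel hrel haK haf, fun h => ?_⟩
  have h' := mem_cohForms_comp_mul_right_of_rel (rel_symm hrel) (fun k hk => (haK k hk).inv_right)
    (fun g => (haf g).inv_right) h
  rwa [comp_mul_right_inv_cancel] at h'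

end Generic

/-! ## §2 Frames of the CM datum: `u₀ = T'⁻¹ T ∈ U(2,1)`, conjugate sections, frame-free compact factor, commutations -/

section Frames

/-- `σ((S T))ᵀ H (S T) = σ(T)ᵀ (σ(S)ᵀ H S) T`: `formCongr` is a right action. [folklore] -/
theorem formCongr_mul {R : Type*} [CommRing R] {n : Type*} [Fintype n] [DecidableEq n] (σ : R →+* R) (S T : GL n R)
    (A : Matrix n n R) : formCongr σ (S * T) A = formCongr σ T (formCongr σ S A) := by
  simp only [formCongr, Units.val_mul, Matrix.map_mul, Matrix.transpose_mul, Matrix.mul_assoc]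

variable (L : Type) [Field L] [NumberField L] [IsCMField L] (ι : L →+* ℂ) (H : Matrix (Fin 3) (Fin 3) L) (T T' : GL (Fin 3) ℂ)
  (hT : (T : Matrix (Fin 3) (Fin 3) ℂ)ᴴ * H.map ι * (T : Matrix (Fin 3) (Fin 3) ℂ) = BallModel.J)
  (hT' : (T' : Matrix (Fin 3) (Fin 3) ℂ)ᴴ * H.map ι * (T' : Matrix (Fin 3) (Fin 3) ℂ) = BallModel.J)

omit [NumberField L] [IsCMField L] in
include hT hT' in
/-- **Two frames of the same hermitian form differ by an element of `U(2,1)`**: `(T'⁻¹T)ᴴ J (T'⁻¹T) = Tᴴ (T'⁻ᴴ J T'⁻¹) T = Tᴴ H^ι T = J`.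
[cite: PlatonovRapinchuk1994, §2.3] -/
theorem inv_mul_mem_U21 : T'⁻¹ * T ∈ U21 := by
  rw [U21_eq_unitaryGroupOfForm, mem_unitaryGroupOfForm_iff]
  change formCongr (starRingEnd ℂ) (T'⁻¹ * T) BallModel.J = BallModel.J
  have h1 : formCongr (starRingEnd ℂ) T'⁻¹ BallModel.J = H.map ι := by
    rw [← formCongr_eq_of_conjTranspose L ι H T' hT', formCongr_inv_formCongr]
  rw [formCongr_mul, h1]
  exact formCongr_eq_of_conjTranspose L ι H T hT

/-- **The sections through two frames are conjugate**: with `u₀ = T'⁻¹ T ∈ U(2,1)`, `cmArchSection T u = cmArchSection T' (u₀ u u₀⁻¹)` for every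
`u ∈ U(2,1)` (both are the archimedean element with `ι`-component `T u T⁻¹ = T' (u₀ u u₀⁻¹) T'⁻¹` and trivial other components).
[cite: BorelJacquet1979, §4.1] [cite: PlatonovRapinchuk1994, §2.3] -/
theorem exists_cmArchSection_eq_conj : ∃ u₀ : U21, ((u₀ : GL (Fin 3) ℂ) = T'⁻¹ * T) ∧
    ∀ u : U21, cmArchSection L ι H T hT u = cmArchSection L ι H T' hT' (u₀ * u * u₀⁻¹) := by
  refine ⟨⟨T'⁻¹ * T, inv_mul_mem_U21 L ι H T T' hT hT'⟩, rfl, fun u => ?_⟩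
  rw [cmArchSection_eq, cmArchSection_eq]
  unfold archSectionU21CM
  rw [archSectionU21Emb_apply, archSectionU21Emb_apply]
  congr 2
  apply Subtype.ext
  rw [coe_formEquivU21_symm_apply, coe_formEquivU21_symm_apply, Subgroup.coe_mul, Subgroup.coe_mul, Subgroup.coe_inv]
  change T * (u : GL (Fin 3) ℂ) * T⁻¹ = T' * (T'⁻¹ * T * (u : GL (Fin 3) ℂ) * (T'⁻¹ * T)⁻¹) * T'⁻¹
  group

/-- **The compact archimedean factor is frame-free**: `cmCompactFactor T = cmCompactFactor T'` (both are `archToAdelic (ker archAt v(ι))`, ★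
`ker_archProjU21Emb`). [cite: BorelJacquet1979, §4.1] -/
theorem cmCompactFactor_eq_of_frames : cmCompactFactor L ι H T hT = cmCompactFactor L ι H T' hT' := by
  rw [cmCompactFactor_eq, cmCompactFactor_eq]
  unfold archProjU21EmbCM
  rw [ker_archProjU21Emb, ker_archProjU21Emb]

/-- The compact factor in the frame-free currency of ★ `UnitaryGroupArchFactor`: `cmCompactFactor T = archToAdelic (ker archAt v(ι))`.
[cite: BorelJacquet1979, §4.1] -/
theorem cmCompactFactor_eq_map_ker_archAt : cmCompactFactor L ι H T hT =
    ((archAt (↥(maximalRealSubfield L)) L (IsCMField.complexConj L) 3 H (cmPlace L ι) (UnitaryGroup.complexConj_smul_infinitePlace L _)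
      (IsCMField.complexConj_ne_one L)).ker).map (archToAdelic (↥(maximalRealSubfield L)) L (IsCMField.complexConj L) 3 H) := by
  rw [cmCompactFactor_eq]
  unfold archProjU21EmbCM
  rw [ker_archProjU21Emb]

/-- **The section commutes with the finite adeles**: `(1, g) · ι_T(u) = ι_T(u) · (1, g)`. [cite: BorelJacquet1979, §4.1] -/
theorem commute_finAdelicToAdelic_cmArchSection (g : finAdelic (↥(maximalRealSubfield L)) L (IsCMField.complexConj L) 3 H) (u : U21) :
    Commute (finAdelicToAdelic (↥(maximalRealSubfield L)) L (IsCMField.complexConj L) 3 H g) (cmArchSection L ι H T hT u) :=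
  commute_archSectionU21CM_of_mem_awayFromCM L ι H T hT u
    (finAdelicToAdelic_mem_awayFrom (↥(maximalRealSubfield L)) L (IsCMField.complexConj L) 3 H _ _ (cmPlace L ι) g)

/-- **The section commutes with the compact factor** of ANY frame `T'` (the factor is frame-free): `k · ι_T(u) = ι_T(u) · k` for `k ∈ K_c`.
[cite: BorelJacquet1979, §4.1] -/
theorem commute_cmArchSection_of_mem_cmCompactFactor {k : (adelicGroupData (↥(maximalRealSubfield L)) L (IsCMField.complexConj L) 3 H).Adelic}
    (hk : k ∈ cmCompactFactor L ι H T' hT') (u : U21) : Commute k (cmArchSection L ι H T hT u) := by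
  rw [cmCompactFactor_eq_map_ker_archAt] at hk
  exact commute_archSectionU21CM_of_mem_awayFromCM L ι H T hT u
    (map_ker_archAt_le_awayFrom (↥(maximalRealSubfield L)) L (IsCMField.complexConj L) 3 H _ _ (cmPlace L ι) hk)

end Frames

/-! ## §3 The frame transport `(L, ι, H, T) ↦ (L, ι, H, T')` of `hol`, `antihol`, `coh` -/

section Transport

variable (L : Type) [Field L] [NumberField L] [IsCMField L] (ι : L →+* ℂ) (H : Matrix (Fin 3) (Fin 3) L) (T T' : GL (Fin 3) ℂ)
  (hT : (T : Matrix (Fin 3) (Fin 3) ℂ)ᴴ * H.map ι * (T : Matrix (Fin 3) (Fin 3) ℂ) = BallModel.J)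
  (hT' : (T' : Matrix (Fin 3) (Fin 3) ℂ)ᴴ * H.map ι * (T' : Matrix (Fin 3) (Fin 3) ℂ) = BallModel.J)

/-- **THE FRAME TRANSPORT.**  For two frames `T, T'` of the CM datum `(L, ι, H)` there is `a ∈ U(H)(𝔸_{L⁺})` — namely `a = ι_{T'}(u₀)⁻¹`,
`u₀ = T'⁻¹T` — in the range of the section `ι_{T'}`, commuting with `U(H)(𝔸_{L⁺,f})` and with the compact factor, intertwining the sections
(`ι_{T'}(u) a = a ι_T(u)`), such that right translation by `a` identifies the holomorphic, the antiholomorphic and the cohomological cotangent forms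
of the frame `T` with those of the frame `T'`: `Φ ∈ hol_T ↔ Φ(· a) ∈ hol_{T'}`, etc. [cite: BorelJacquet1979, §4.1, §4.2] [cite: Borel1997, §5.14]
[cite: BorelWallach2000, VII 2.10] [cite: PlatonovRapinchuk1994, §2.3] -/
theorem exists_frameTransport :
    ∃ a : (adelicGroupData (↥(maximalRealSubfield L)) L (IsCMField.complexConj L) 3 H).Adelic,
      a ∈ (cmArchSection L ι H T' hT').range ∧
      (∀ g : finAdelic (↥(maximalRealSubfield L)) L (IsCMField.complexConj L) 3 H,
        Commute (finAdelicToAdelic (↥(maximalRealSubfield L)) L (IsCMField.complexConj L) 3 H g) a) ∧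
      (∀ k ∈ cmCompactFactor L ι H T hT, Commute k a) ∧
      (∀ u : U21, cmArchSection L ι H T' hT' u * a = a * cmArchSection L ι H T hT u) ∧
      (∀ Φ : (adelicGroupData (↥(maximalRealSubfield L)) L (IsCMField.complexConj L) 3 H).Adelic → (Fin 2 → ℂ),
        Φ ∈ holCotForms (↥(maximalRealSubfield L)) L (IsCMField.complexConj L) 3 H (cmArchSection L ι H T hT) (cmCompactFactor L ι H T hT) ↔
        (fun y => Φ (y * a)) ∈ holCotForms (↥(maximalRealSubfield L)) L (IsCMField.complexConj L) 3 H (cmArchSection L ι H T' hT')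
          (cmCompactFactor L ι H T' hT')) ∧
      (∀ Φ : (adelicGroupData (↥(maximalRealSubfield L)) L (IsCMField.complexConj L) 3 H).Adelic → (Fin 2 → ℂ),
        Φ ∈ (holCotForms (↥(maximalRealSubfield L)) L (IsCMField.complexConj L) 3 H (cmArchSection L ι H T hT)
          (cmCompactFactor L ι H T hT)).map (conjFun (↥(maximalRealSubfield L)) L (IsCMField.complexConj L) 3 H) ↔
        (fun y => Φ (y * a)) ∈ (holCotForms (↥(maximalRealSubfield L)) L (IsCMField.complexConj L) 3 H (cmArchSection L ι H T' hT')
          (cmCompactFactor L ι H T' hT')).map (conjFun (↥(maximalRealSubfield L)) L (IsCMField.complexConj L) 3 H)) ∧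
      (∀ Φ : (adelicGroupData (↥(maximalRealSubfield L)) L (IsCMField.complexConj L) 3 H).Adelic → (Fin 2 → ℂ),
        Φ ∈ cohForms (↥(maximalRealSubfield L)) L (IsCMField.complexConj L) 3 H (cmArchSection L ι H T hT) (cmCompactFactor L ι H T hT) ↔
        (fun y => Φ (y * a)) ∈ cohForms (↥(maximalRealSubfield L)) L (IsCMField.complexConj L) 3 H (cmArchSection L ι H T' hT')
          (cmCompactFactor L ι H T' hT')) := by
  obtain ⟨u₀, -, hconj⟩ := exists_cmArchSection_eq_conj L ι H T T' hT hT'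
  set a : (adelicGroupData (↥(maximalRealSubfield L)) L (IsCMField.complexConj L) 3 H).Adelic := cmArchSection L ι H T' hT' u₀⁻¹ with ha
  have hrel : ∀ u : U21, cmArchSection L ι H T' hT' u * a = a * cmArchSection L ι H T hT u := fun u => by
    rw [ha, hconj u, ← map_mul, ← map_mul]
    congr 1
    group
  have haf : ∀ g : finAdelic (↥(maximalRealSubfield L)) L (IsCMField.complexConj L) 3 H,
      Commute (finAdelicToAdelic (↥(maximalRealSubfield L)) L (IsCMField.complexConj L) 3 H g) a := fun g =>
    commute_finAdelicToAdelic_cmArchSection L ι H T' hT' g u₀⁻¹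
  have haK : ∀ k ∈ cmCompactFactor L ι H T hT, Commute k a := fun k hk =>
    commute_cmArchSection_of_mem_cmCompactFactor L ι H T' T hT' hT hk u₀⁻¹
  have hKc : cmCompactFactor L ι H T' hT' = cmCompactFactor L ι H T hT := cmCompactFactor_eq_of_frames L ι H T' T hT' hT
  refine ⟨a, ⟨u₀⁻¹, rfl⟩, haf, haK, hrel, fun Φ => ?_, fun Φ => ?_, fun Φ => ?_⟩
  · rw [hKc]; exact mem_holCotForms_iff_comp_mul_right_of_rel hrel haK haf Φ
  · rw [hKc]; exact mem_map_conjFun_iff_comp_mul_right_of_rel hrel haK haf Φ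
  · rw [hKc]; exact mem_cohForms_iff_comp_mul_right_of_rel hrel haK haf Φ

/-- **The frame transport, one-way consumer spelling** (F0P2a-p07's S3 shape, token for token up to binder names): `∃ a` commuting with
`U(H)(𝔸_{L⁺,f})` such that `Φ ∈ coh_T ⇒ Φ(· a) ∈ coh_{T'}`. [cite: BorelJacquet1979, §4.1, §4.2] [cite: BorelWallach2000, VII 2.10] -/
theorem mem_cohForms_frameTransport :
    ∃ a : (adelicGroupData (↥(maximalRealSubfield L)) L (IsCMField.complexConj L) 3 H).Adelic,
      (∀ g : finAdelic (↥(maximalRealSubfield L)) L (IsCMField.complexConj L) 3 H,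
        Commute (finAdelicToAdelic (↥(maximalRealSubfield L)) L (IsCMField.complexConj L) 3 H g) a) ∧
      ∀ f ∈ cohForms (↥(maximalRealSubfield L)) L (IsCMField.complexConj L) 3 H (cmArchSection L ι H T hT) (cmCompactFactor L ι H T hT),
        (fun y => f (y * a)) ∈ cohForms (↥(maximalRealSubfield L)) L (IsCMField.complexConj L) 3 H (cmArchSection L ι H T' hT')
          (cmCompactFactor L ι H T' hT') := by
  obtain ⟨a, -, haf, -, -, -, -, hcoh⟩ := exists_frameTransport L ι H T T' hT hT'
  exact ⟨a, haf, fun f hf => (hcoh f).mp hf⟩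

end Transport

end Summit.HodgeConjecture.HodgeConjecture.Cruxes.H413.F0P2aFrameTransport

end
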